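import Mathlib
import Summits.ValiantsHypothesis.ValiantsHypothesis.Theorems.ChowBorderDepth3ChowBorderBoundDefs

/-!
# Stub `stub_epsSpan` of crux `ChowBorderDepth3.ChowBorderBound` (stmt-ValiantsHypothesis-5936),
# line `registered`: the ε-side span membership of exact DiDIL at top fan-in 2

Ambient ring `Â = MvPolynomial (Option (Fin n × Fin n)) ℂ`: the variables `X (some v)` are the
matrix variables, `ε := X none` is the distinguished variable, and `ι := Polynomial.aeval ε`
embeds `ℂ[X]` as the "ε-constants" (polynomials in `ε` alone).  Write `∂ := pderiv none` for the
`ε`-derivative and `qdn := QuotDeriv.quotDerivNum` for the quotient-derivative numerator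
(`qdn f g w = g^(|w|+1) · ∂_w (f/g)`).

## Statement

Data: `ε`-affine forms `lam i j = ι a₀ + Σ_v ι (a v) · X (some v)` (`i : Fin 2`, `j : Fin D`),
gates `T_i := Π_j lam i j`, and a cancellation `T₀ + T₁ = ε^(w+1) · B`.  Put
`α i j := ∂ (lam i j)`, `Λ := T₀ · T₁`, `Λ^{ij} := Π_{p ≠ (i,j)} lam p.1 p.2`, and
`P₁ := (w+1) • (B · T₁) + ε · (∂B · T₁ − B · ∂T₁)`.  Then for every word `u` of `t` matrix
variables there are `c d : Fin 2 → Fin D → ℂ[X]` with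
`ε^w · qdn P₁ Λ u = Σ_{i,j} (ι (c i j) · α i j + ι (d i j) · lam i j) · (Λ^{ij})^(t+1)`.

## Proof

1. *Two expressions for `N := ∂T₀ · T₁ − T₀ · ∂T₁`.*  Differentiating the cancellation gives
   `∂T₀ + ∂T₁ = (w+1) ε^w B + ε^(w+1) ∂B`, whence `N = ε^w · P₁` (`eps_pow_mul_P₁`).  The Leibniz
   rule over each gate (`pderiv_finset_prod`) and the splitting of the co-factor products
   `Λ^{0j} = (Π_{j'≠j} lam 0 j') · T₁`, `Λ^{1j} = T₀ · Π_{j'≠j} lam 1 j'` (`prod_erase_zero/one`)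
   give `N = Σ_j α 0 j · Λ^{0j} − Σ_j α 1 j · Λ^{1j}`.
2. *Linearity.*  `ε^w` is killed by every `∂_{some v}`, so `ε^w · qdn P₁ Λ u = qdn N Λ u`
   (`quotDerivNum_const_mul`), and `qdn` is additive in the numerator (`quotDerivNum_sum/_sub`).
3. *Local closed form* (`quotDerivNum_affine_closed_form`, the heart).  For ONE `ε`-affine factor
   `lam` with `α := ∂ lam` and any `M`:
   `qdn (α · M) (lam · M) u = M^(t+1) · (ι c · α + ι d · lam)` for some `c d : ℂ[X]`, by induction
   on the word: `∂_v lam = ι (a v)` and `∂_v α = ι ((a v)')` are `ε`-constants, `∂_v` kills `ι c`,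
   `ι d`, and in the quotient rule the terms carrying `∂_v M` cancel identically, leaving
   `c' = −(t+1) (a v) c`, `d' = (a v)' c − t (a v) d`.
4. *Assembly.*  `Λ = lam i j · Λ^{ij}` (`Finset.mul_prod_erase`), so step 3 applies to every
   summand of step 1 with `M := Λ^{ij}`; the sign of gate `1` is absorbed into `c 1 j, d 1 j`.

References: P. Dutta, P. Dwivedi, N. Saxena, *Demystifying the border of depth-3 algebraic
circuits*, FOCS 2021, IEEE 2022 (DiDIL, §3); folklore calculus.
-/

-- `Summit.ValiantsHypothesis.ValiantsHypothesis.…` is the tree's mandated single-conjunct layout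
-- (Sub = Summit), so the duplicated namespace component is intended.
set_option linter.dupNamespace false

namespace Summit.ValiantsHypothesis.ValiantsHypothesis.Theorems.ChowBorderBound.EpsSpan

open MvPolynomial
open Summit.ValiantsHypothesis.ValiantsHypothesis.Theorems.ChowBorderBound.QuotDeriv
open scoped Polynomial

/-! ## §1 Generic calculus: Leibniz over products, linearity of `quotDerivNum` -/
section Generic

variable {σ R : Type*} [CommRing R]

/-- **Leibniz rule over a finite product**:
`∂_v (Π_{j∈s} Q_j) = Σ_{j∈s} (Π_{j'≠j} Q_{j'}) · ∂_v Q_j`. [folklore] -/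
theorem pderiv_finset_prod {κ : Type*} [DecidableEq κ] (v : σ) (s : Finset κ)
    (Q : κ → MvPolynomial σ R) :
    pderiv v (∏ j ∈ s, Q j) = ∑ j ∈ s, (∏ j' ∈ s.erase j, Q j') * pderiv v (Q j) := by
  induction s using Finset.induction_on with
  | empty => simp
  | insert a s ha ih =>
    rw [Finset.prod_insert ha, pderiv_mul, ih, Finset.sum_insert ha, Finset.erase_insert ha,
      Finset.mul_sum]
    congr 1
    · ring
    · refine Finset.sum_congr rfl fun j hj => ?_
      have hne : a ≠ j := fun h => ha (h ▸ hj)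
      rw [Finset.erase_insert_of_ne hne,
        Finset.prod_insert (fun h => ha (Finset.mem_of_mem_erase h))]
      ring

/-- `quotDerivNum` is subtractive in the numerator. [folklore] -/
theorem quotDerivNum_sub (f₁ f₂ g : MvPolynomial σ R) (w : List σ) :
    quotDerivNum (f₁ - f₂) g w = quotDerivNum f₁ g w - quotDerivNum f₂ g w := by
  have h := quotDerivNum_add (f₁ - f₂) f₂ g w
  rw [sub_add_cancel] at h
  rw [h, add_sub_cancel_right]

/-- `quotDerivNum` commutes with finite sums in the numerator. [folklore] -/
theorem quotDerivNum_sum {κ : Type*} (s : Finset κ) (f : κ → MvPolynomial σ R)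
    (g : MvPolynomial σ R) (w : List σ) :
    quotDerivNum (∑ x ∈ s, f x) g w = ∑ x ∈ s, quotDerivNum (f x) g w := by
  classical
  induction s using Finset.induction_on with
  | empty => rw [Finset.sum_empty, Finset.sum_empty, quotDerivNum_zero_left]
  | insert a s ha ih => rw [Finset.sum_insert ha, Finset.sum_insert ha, quotDerivNum_add, ih]

/-- Splitting the co-factor product of the cell `(0, j)` of a `2 × D` array:
`Π_{p ≠ (0,j)} f p.1 p.2 = (Π_{j' ≠ j} f 0 j') · Π_{j'} f 1 j'`. [folklore] -/
theorem prod_erase_zero {M : Type*} [CommMonoid M] {D : ℕ} (f : Fin 2 → Fin D → M) (j : Fin D) :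
    ∏ p ∈ Finset.univ.erase ((0 : Fin 2), j), f p.1 p.2 =
      (∏ j' ∈ Finset.univ.erase j, f 0 j') * ∏ j', f 1 j' := by
  rw [← Finset.filter_ne' Finset.univ ((0 : Fin 2), j), Finset.prod_filter,
    Fintype.prod_prod_type, Fin.prod_univ_two, ← Finset.filter_ne' Finset.univ j,
    Finset.prod_filter]
  exact congrArg₂ (· * ·) (Finset.prod_congr rfl fun j' _ => by simp)
    (Finset.prod_congr rfl fun j' _ => by simp)

/-- Splitting the co-factor product of the cell `(1, j)` of a `2 × D` array:
`Π_{p ≠ (1,j)} f p.1 p.2 = (Π_{j'} f 0 j') · Π_{j' ≠ j} f 1 j'`. [folklore] -/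
theorem prod_erase_one {M : Type*} [CommMonoid M] {D : ℕ} (f : Fin 2 → Fin D → M) (j : Fin D) :
    ∏ p ∈ Finset.univ.erase ((1 : Fin 2), j), f p.1 p.2 =
      (∏ j', f 0 j') * ∏ j' ∈ Finset.univ.erase j, f 1 j' := by
  rw [← Finset.filter_ne' Finset.univ ((1 : Fin 2), j), Finset.prod_filter,
    Fintype.prod_prod_type, Fin.prod_univ_two, ← Finset.filter_ne' Finset.univ j,
    Finset.prod_filter]
  exact congrArg₂ (· * ·) (Finset.prod_congr rfl fun j' _ => by simp)
    (Finset.prod_congr rfl fun j' _ => by simp)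

/-- The numerator of the logarithmic derivative of `T₀ / T₁` for two gates `T_i = Π_j lam i j`,
expanded by the Leibniz rule:
`∂T₀ · T₁ − T₀ · ∂T₁ = Σ_j ∂(lam 0 j) · Λ^{0j} − Σ_j ∂(lam 1 j) · Λ^{1j}`
with `Λ^{ij} := Π_{p ≠ (i,j)} lam p.1 p.2`. [folklore] -/
theorem wronskian_num_eq {D : ℕ} (v : σ) (lam : Fin 2 → Fin D → MvPolynomial σ R) :
    pderiv v (∏ j, lam 0 j) * (∏ j, lam 1 j) - (∏ j, lam 0 j) * pderiv v (∏ j, lam 1 j) =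
      ∑ j, pderiv v (lam 0 j) * ∏ p ∈ Finset.univ.erase ((0 : Fin 2), j), lam p.1 p.2 -
        ∑ j, pderiv v (lam 1 j) * ∏ p ∈ Finset.univ.erase ((1 : Fin 2), j), lam p.1 p.2 := by
  have h0 : pderiv v (∏ j, lam 0 j) =
      ∑ j, (∏ j' ∈ Finset.univ.erase j, lam 0 j') * pderiv v (lam 0 j) :=
    pderiv_finset_prod v Finset.univ (lam 0)
  have h1 : pderiv v (∏ j, lam 1 j) =
      ∑ j, (∏ j' ∈ Finset.univ.erase j, lam 1 j') * pderiv v (lam 1 j) :=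
    pderiv_finset_prod v Finset.univ (lam 1)
  rw [h0, h1, Finset.sum_mul, Finset.mul_sum]
  congr 1
  · refine Finset.sum_congr rfl fun j _ => ?_
    rw [prod_erase_zero]
    ring
  · refine Finset.sum_congr rfl fun j _ => ?_
    rw [prod_erase_one]
    ring

end Generic

/-! ## §2 The `ε`-constants `ι p` and `ε`-affine forms under partial derivatives -/
section EpsConstants

variable {σ R : Type*} [CommRing R]

/-- `ι p = p(ε)` does not involve the matrix variables: `∂_{x_v} (ι p) = 0`. [folklore] -/
theorem pderiv_some_aeval (v : σ) (p : R[X]) :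
    pderiv (some v) ((Polynomial.aeval (X none : MvPolynomial (Option σ) R)) p) = 0 := by
  induction p using Polynomial.induction_on' with
  | add p q hp hq => rw [map_add, map_add, hp, hq, add_zero]
  | monomial k c =>
    rw [← Polynomial.C_mul_X_pow_eq_monomial, map_mul, map_pow, Polynomial.aeval_C,
      Polynomial.aeval_X, algebraMap_eq, pderiv_C_mul, pderiv_pow,
      pderiv_X_of_ne (Option.some_ne_none v).symm, mul_zero, mul_zero]

/-- The `ε`-derivative of an `ε`-constant is the `ε`-constant of the derivative:
`∂ (ι p) = ι (p')`. [folklore] -/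
theorem pderiv_none_aeval (p : R[X]) :
    pderiv none ((Polynomial.aeval (X none : MvPolynomial (Option σ) R)) p) =
      (Polynomial.aeval (X none : MvPolynomial (Option σ) R)) (Polynomial.derivative p) := by
  induction p using Polynomial.induction_on' with
  | add p q hp hq => rw [map_add, map_add, hp, hq, map_add, map_add]
  | monomial k c =>
    rw [← Polynomial.C_mul_X_pow_eq_monomial, map_mul, map_pow, Polynomial.aeval_C,
      Polynomial.aeval_X, algebraMap_eq, pderiv_C_mul, pderiv_pow, pderiv_X_self, mul_one,
      Polynomial.derivative_C_mul_X_pow, map_mul, map_pow, Polynomial.aeval_C, Polynomial.aeval_X,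
      algebraMap_eq, map_mul, map_natCast]
    ring

/-- The `x_v`-derivative of an `ε`-affine form `ι b₀ + Σ_{v'} ι (b v') x_{v'}` is the
`ε`-constant `ι (b v)`. [folklore] -/
theorem pderiv_some_affine [Fintype σ] [DecidableEq σ] (b₀ : R[X]) (b : σ → R[X]) (v : σ) :
    pderiv (some v) ((Polynomial.aeval (X none : MvPolynomial (Option σ) R)) b₀ +
      ∑ v', (Polynomial.aeval (X none : MvPolynomial (Option σ) R)) (b v') * X (some v')) =
      (Polynomial.aeval (X none : MvPolynomial (Option σ) R)) (b v) := by
  simp only [map_add, map_sum, pderiv_mul, pderiv_some_aeval, zero_mul, zero_add, pderiv_X,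
    Pi.single_apply, Option.some.injEq, mul_ite, mul_one, mul_zero, Finset.sum_ite_eq',
    Finset.mem_univ, if_true]

/-- The `ε`-derivative of an `ε`-affine form is the `ε`-affine form of the derivatives:
`∂ (ι b₀ + Σ ι (b v') x_{v'}) = ι b₀' + Σ ι (b v')' x_{v'}`. [folklore] -/
theorem pderiv_none_affine [Fintype σ] (b₀ : R[X]) (b : σ → R[X]) :
    pderiv none ((Polynomial.aeval (X none : MvPolynomial (Option σ) R)) b₀ +
      ∑ v', (Polynomial.aeval (X none : MvPolynomial (Option σ) R)) (b v') * X (some v')) =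
      (Polynomial.aeval (X none : MvPolynomial (Option σ) R)) (Polynomial.derivative b₀) +
        ∑ v', (Polynomial.aeval (X none : MvPolynomial (Option σ) R))
          (Polynomial.derivative (b v')) * X (some v') := by
  simp only [map_add, map_sum, pderiv_mul, pderiv_none_aeval,
    pderiv_X_of_ne (Option.some_ne_none _), mul_zero, add_zero]

/-- **Local closed form** (the heart of the `ε`-side of DiDIL).  For an `ε`-affine `lam` with
`α := ∂ lam` and any co-factor `M`, along every word of matrix variables `l` (of length `t`)
`qdn (α · M) (lam · M) l = M^(t+1) · (ι c · α + ι d · lam)` for some `c d : ℂ[X]`: in the quotient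
rule the terms carrying `∂_v M` cancel identically. [cite: DuttaDwivediSaxena2022, §3] -/
theorem quotDerivNum_affine_closed_form [Fintype σ] [DecidableEq σ] (a₀ : R[X]) (a : σ → R[X])
    (lam M : MvPolynomial (Option σ) R)
    (hlam : lam = (Polynomial.aeval (X none : MvPolynomial (Option σ) R)) a₀ +
      ∑ v, (Polynomial.aeval (X none : MvPolynomial (Option σ) R)) (a v) * X (some v))
    (l : List σ) :
    ∃ c d : R[X], quotDerivNum (pderiv none lam * M) (lam * M) (l.map some) =
      M ^ (l.length + 1) *
        ((Polynomial.aeval (X none : MvPolynomial (Option σ) R)) c * pderiv none lam +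
          (Polynomial.aeval (X none : MvPolynomial (Option σ) R)) d * lam) := by
  induction l with
  | nil =>
    refine ⟨1, 0, ?_⟩
    rw [List.map_nil, quotDerivNum_nil, List.length_nil, zero_add, pow_one, map_one, map_zero,
      one_mul, zero_mul, add_zero, mul_comm]
  | cons v l ih =>
    obtain ⟨c, d, h⟩ := ih
    have hlv : pderiv (some v) lam =
        (Polynomial.aeval (X none : MvPolynomial (Option σ) R)) (a v) := by
      rw [hlam, pderiv_some_affine]
    have hav : pderiv (some v) (pderiv none lam) =
        (Polynomial.aeval (X none : MvPolynomial (Option σ) R)) (Polynomial.derivative (a v)) := by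
      rw [hlam, pderiv_none_affine, pderiv_some_affine]
    refine ⟨-(((l.length : R[X]) + 1) * a v * c),
      Polynomial.derivative (a v) * c - (l.length : R[X]) * a v * d, ?_⟩
    rw [List.map_cons, quotDerivNum_cons, h, List.length_map, List.length_cons]
    simp only [pderiv_mul, pderiv_pow, map_add, hlv, hav, pderiv_some_aeval, zero_mul, zero_add,
      nsmul_eq_mul, map_mul, map_neg, map_sub, map_one, map_natCast, Nat.cast_add,
      Nat.cast_one, Nat.add_sub_cancel]
    ring

end EpsConstants

/-! ## §3 The registered stub -/

/-- **Stub `stub_epsSpan`** (registered stub of crux stmt-ValiantsHypothesis-5936, line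
`registered`; the `ε`-side heart of exact DiDIL at top fan-in `2`).  For `ε`-affine forms
`lam i j` (`i : Fin 2`, `j : Fin D`) with `Π_j lam 0 j + Π_j lam 1 j = ε^(w+1) · B`, every
quotient-derivative numerator of `P₁ / (T₀ T₁)` along a word of `t` matrix variables, multiplied by
`ε^w`, lies in `Σ_{i,j} ι(ℂ[X]) · ∂(lam i j) · (Λ^{ij})^(t+1) + ι(ℂ[X]) · lam i j · (Λ^{ij})^(t+1)`,
where `P₁ := (w+1) • (B · T₁) + ε · (∂B · T₁ − B · ∂T₁)` and `Λ^{ij} := Π_{p ≠ (i,j)} lam p.1 p.2`.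
[cite: DuttaDwivediSaxena2022, §3] -/
theorem stub_epsSpan :
    ∀ (n D w : ℕ) (lam : Fin 2 → Fin D → MvPolynomial (Option (Fin n × Fin n)) ℂ)
      (B : MvPolynomial (Option (Fin n × Fin n)) ℂ),
      (∀ i j, ∃ (a₀ : Polynomial ℂ) (a : Fin n × Fin n → Polynomial ℂ),
        lam i j = Polynomial.aeval (MvPolynomial.X (none : Option (Fin n × Fin n)) : MvPolynomial (Option (Fin n × Fin n)) ℂ) (a₀) +
          ∑ v : Fin n × Fin n, Polynomial.aeval (MvPolynomial.X (none : Option (Fin n × Fin n)) : MvPolynomial (Option (Fin n × Fin n)) ℂ) (a v) * MvPolynomial.X (some v)) →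
      (∏ j, lam 0 j) + (∏ j, lam 1 j) = (MvPolynomial.X (none : Option (Fin n × Fin n)) : MvPolynomial (Option (Fin n × Fin n)) ℂ) ^ (w + 1) * B →
      ∀ (t : ℕ) (u : Fin t → Fin n × Fin n), ∃ (c d : Fin 2 → Fin D → Polynomial ℂ),
        (MvPolynomial.X (none : Option (Fin n × Fin n)) : MvPolynomial (Option (Fin n × Fin n)) ℂ) ^ w *
            Summit.ValiantsHypothesis.ValiantsHypothesis.Theorems.ChowBorderBound.QuotDeriv.quotDerivNum
              ((w + 1) • (B * ∏ j, lam 1 j) +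
            (MvPolynomial.X (none : Option (Fin n × Fin n)) : MvPolynomial (Option (Fin n × Fin n)) ℂ) *
              (MvPolynomial.pderiv none B * ∏ j, lam 1 j - B * MvPolynomial.pderiv none (∏ j, lam 1 j)))
              ((∏ j, lam 0 j) * ∏ j, lam 1 j) (List.ofFn fun k => some (u k)) =
          ∑ i : Fin 2, ∑ j : Fin D,
            (Polynomial.aeval (MvPolynomial.X (none : Option (Fin n × Fin n)) : MvPolynomial (Option (Fin n × Fin n)) ℂ) (c i j) * MvPolynomial.pderiv none (lam i j) +
                Polynomial.aeval (MvPolynomial.X (none : Option (Fin n × Fin n)) : MvPolynomial (Option (Fin n × Fin n)) ℂ) (d i j) * lam i j) *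
              (∏ p ∈ Finset.univ.erase (i, j), lam p.1 p.2) ^ (t + 1) := by
  intro n D w lam B hlam hsum t u
  classical
  choose a₀ a ha using hlam
  -- Step 3 (local closed form) for every cell `(i, j)` with co-factor `M := Λ^{ij}`
  have hkey : ∀ i j, ∃ c d : ℂ[X],
      quotDerivNum (pderiv none (lam i j) * ∏ p ∈ Finset.univ.erase (i, j), lam p.1 p.2)
        (lam i j * ∏ p ∈ Finset.univ.erase (i, j), lam p.1 p.2) (List.ofFn fun k => some (u k)) =
      (∏ p ∈ Finset.univ.erase (i, j), lam p.1 p.2) ^ (t + 1) *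
        ((Polynomial.aeval (X none : MvPolynomial (Option (Fin n × Fin n)) ℂ)) c *
            pderiv none (lam i j) +
          (Polynomial.aeval (X none : MvPolynomial (Option (Fin n × Fin n)) ℂ)) d * lam i j) := by
    intro i j
    have h := quotDerivNum_affine_closed_form (a₀ i j) (a i j) (lam i j)
      (∏ p ∈ Finset.univ.erase (i, j), lam p.1 p.2) (ha i j) (List.ofFn u)
    rwa [← List.ofFn_comp', List.length_ofFn] at h
  choose c d hcd using hkey
  refine ⟨![c 0, fun j => -c 1 j], ![d 0, fun j => -d 1 j], ?_⟩
  -- Step 1 (i): `ε^w · P₁ = N := ∂T₀ · T₁ − T₀ · ∂T₁`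
  have hd : pderiv none (∏ j, lam 0 j) + pderiv none (∏ j, lam 1 j) =
      ((w : MvPolynomial (Option (Fin n × Fin n)) ℂ) + 1) * X none ^ w * B +
        X none ^ (w + 1) * pderiv none B := by
    have h := congrArg (pderiv none) hsum
    simp only [map_add, pderiv_mul, pderiv_pow, pderiv_X_self, mul_one, Nat.cast_add,
      Nat.cast_one, Nat.add_sub_cancel] at h
    rw [h]
  have hN : (X none : MvPolynomial (Option (Fin n × Fin n)) ℂ) ^ w *
      ((w + 1) • (B * ∏ j, lam 1 j) +
        X none * (pderiv none B * ∏ j, lam 1 j - B * pderiv none (∏ j, lam 1 j))) =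
      pderiv none (∏ j, lam 0 j) * (∏ j, lam 1 j) -
        (∏ j, lam 0 j) * pderiv none (∏ j, lam 1 j) := by
    simp only [nsmul_eq_mul, Nat.cast_add, Nat.cast_one]
    linear_combination (-(∏ j, lam 1 j)) * hd + pderiv none (∏ j, lam 1 j) * hsum
  -- Step 1 (ii): `N = Σ_j α 0 j · Λ^{0j} − Σ_j α 1 j · Λ^{1j}`
  have hN' : pderiv none (∏ j, lam 0 j) * (∏ j, lam 1 j) -
      (∏ j, lam 0 j) * pderiv none (∏ j, lam 1 j) =
      ∑ j, pderiv none (lam 0 j) * ∏ p ∈ Finset.univ.erase ((0 : Fin 2), j), lam p.1 p.2 -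
        ∑ j, pderiv none (lam 1 j) * ∏ p ∈ Finset.univ.erase ((1 : Fin 2), j), lam p.1 p.2 :=
    wronskian_num_eq none lam
  -- Step 2: `ε^w` is an `x`-constant and `qdn` is additive in the numerator
  have hconst : ∀ v ∈ List.ofFn (fun k => some (u k)),
      pderiv v ((X none : MvPolynomial (Option (Fin n × Fin n)) ℂ) ^ w) = 0 := by
    intro v hv
    obtain ⟨k, rfl⟩ := List.mem_ofFn.1 hv
    rw [pderiv_pow, pderiv_X_of_ne (Option.some_ne_none (u k)).symm, mul_zero]
  rw [← quotDerivNum_const_mul _ _ _ _ hconst, hN, hN', quotDerivNum_sub, quotDerivNum_sum,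
    quotDerivNum_sum]
  -- Step 4: `Λ = lam i j · Λ^{ij}`, apply the closed form cell by cell, and regroup
  have hΛ : ∀ i j, lam i j * ∏ p ∈ Finset.univ.erase (i, j), lam p.1 p.2 =
      (∏ j, lam 0 j) * ∏ j, lam 1 j := by
    intro i j
    have h := Finset.mul_prod_erase Finset.univ (fun p : Fin 2 × Fin D => lam p.1 p.2)
      (Finset.mem_univ (i, j))
    rw [Fintype.prod_prod_type, Fin.prod_univ_two] at h
    exact h
  have h0 : ∑ j, quotDerivNum (pderiv none (lam 0 j) * ∏ p ∈ Finset.univ.erase ((0 : Fin 2), j),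
      lam p.1 p.2) ((∏ j, lam 0 j) * ∏ j, lam 1 j) (List.ofFn fun k => some (u k)) =
      ∑ j, (∏ p ∈ Finset.univ.erase ((0 : Fin 2), j), lam p.1 p.2) ^ (t + 1) *
        ((Polynomial.aeval (X none : MvPolynomial (Option (Fin n × Fin n)) ℂ)) (c 0 j)
            * pderiv none (lam 0 j) +
          (Polynomial.aeval (X none : MvPolynomial (Option (Fin n × Fin n)) ℂ)) (d 0 j) *
            lam 0 j) :=
    Finset.sum_congr rfl fun j _ => by rw [← hΛ 0 j, hcd 0 j]
  have h1 : ∑ j, quotDerivNum (pderiv none (lam 1 j) * ∏ p ∈ Finset.univ.erase ((1 : Fin 2), j),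
      lam p.1 p.2) ((∏ j, lam 0 j) * ∏ j, lam 1 j) (List.ofFn fun k => some (u k)) =
      ∑ j, (∏ p ∈ Finset.univ.erase ((1 : Fin 2), j), lam p.1 p.2) ^ (t + 1) *
        ((Polynomial.aeval (X none : MvPolynomial (Option (Fin n × Fin n)) ℂ)) (c 1 j)
            * pderiv none (lam 1 j) +
          (Polynomial.aeval (X none : MvPolynomial (Option (Fin n × Fin n)) ℂ)) (d 1 j) *
            lam 1 j) :=
    Finset.sum_congr rfl fun j _ => by rw [← hΛ 1 j, hcd 1 j]
  rw [h0, h1, Fin.sum_univ_two, sub_eq_add_neg, ← Finset.sum_neg_distrib]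
  simp only [Matrix.cons_val_zero, Matrix.cons_val_one, map_neg]
  congr 1 <;> refine Finset.sum_congr rfl fun j _ => ?_ <;> ring

end Summit.ValiantsHypothesis.ValiantsHypothesis.Theorems.ChowBorderBound.EpsSpan
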